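import Mathlib
import Summits.Ventures.PercRepro2.V2SP
import Summits.Ventures.PercRepro2.Tail2DCount
import Summits.Ventures.PercRepro2.Tail2DThreePoint
import Summits.Ventures.PercRepro2.Tail2DThreePointComm
import Summits.Ventures.PercRepro2.Tail2DFlowTwo

/-!
# The flow-two step on a concrete cube: `(P(e²) ∧ P(e²)) ∗ (P(e²) ∧ P(e²))` (seat mine-b, cell pub-perc-repro2)

`bb = P(e²) ∧ P(e²)` (two bundles of two free edges in series) has max-flow `2` and flow counts
`(1, 4, 4, 4, 1, 2)` at `(2,0), (1,1), (0,2), (1,0), (0,1), (0,0)`, which satisfy the six minors of the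
flow-two step (`Tail2DFlowTwo.lean`) — all checked by `decide` on the 64 configurations.  Hence every
pattern of the M♮ class stays in the class under parallel composition with `bb` (`MTailPat.par_bb`), and
in particular the 8-edge network `bb ∗ bb` (max-flow 4, neither bundle-parallel nor in `Good`) has an
M♮-concave counting tail (`mtail_bb_par_bb`): (TAIL-M♮), (TAIL-LC) and BAL hold on its cube.
-/

namespace Summit.Ventures.PercRepro2.Tail2D

open V2Closure

/-- the network `P(e²) ∧ P(e²)`: two bundles of two free edges in series -/
def bb : V2Closure.SP := .ser (.par .free .free) (.par .free .free)

/-- `bb` has max-flow `≤ 2` -/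
theorem bb_flowLeTwo : FlowLeTwo bb := by unfold FlowLeTwo; decide

/-- the six minors of `bb` (flow counts `n₀₀ = 2, n₁₀ = n₀₁ = 4, n₂₀ = n₀₂ = 1, n₁₁ = 4`) -/
theorem bb_minors :
    flowCount bb 0 0 * flowCount bb 2 0 ≤ flowCount bb 1 0 * flowCount bb 1 0 ∧
    flowCount bb 0 0 * flowCount bb 0 2 ≤ flowCount bb 0 1 * flowCount bb 0 1 ∧
    flowCount bb 2 0 * flowCount bb 0 2 ≤ flowCount bb 1 1 * flowCount bb 1 1 ∧
    flowCount bb 2 0 * flowCount bb 0 1 ≤ flowCount bb 1 0 * flowCount bb 1 1 ∧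
    flowCount bb 0 2 * flowCount bb 1 0 ≤ flowCount bb 0 1 * flowCount bb 1 1 ∧
    flowCount bb 0 0 * flowCount bb 1 1 ≤ flowCount bb 1 0 * flowCount bb 0 1 := by
  unfold flowCount bb; decide

/-- `bb` attains the flows `(2,0)`, `(1,1)` and `(0,2)` -/
theorem bb_top : (∃ y : bb.Conf, bb.rLab y = 2 ∧ bb.bLab y = 0) ∧ (∃ y : bb.Conf, bb.rLab y = 1 ∧ bb.bLab y = 1)
    ∧ (∃ y : bb.Conf, bb.rLab y = 0 ∧ bb.bLab y = 2) :=
  ⟨⟨((false, false), (false, false)), by decide⟩, ⟨((false, true), (false, true)), by decide⟩,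
    ⟨((true, true), (true, true)), by decide⟩⟩

/-- parallel composition with `bb` keeps the M♮ class (either side) -/
theorem MTailPat.par_bb {s : V2Closure.SP} {L : ℤ} (hs : MTailPat s L) :
    MTailPat (.par s bb) (L + 2) ∧ MTailPat (.par bb s) (L + 2) :=
  MTailPat.par_flow2 hs bb bb_flowLeTwo bb_top.1 bb_top.2.1 bb_top.2.2 bb_minors.1 bb_minors.2.1
    bb_minors.2.2.1 bb_minors.2.2.2.1 bb_minors.2.2.2.2.1 bb_minors.2.2.2.2.2

/-- `bb` itself is in the class (it is `Good`: series of two bundle-parallel terms) -/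
theorem mtail_bb : MTailPat bb 2 := by
  have h : Good bb (min 2 2) :=
    Good.ser (Good.par .free Good.free flowLeOne_free ⟨false, by decide⟩ ⟨true, by decide⟩)
      (Good.par .free Good.free flowLeOne_free ⟨false, by decide⟩ ⟨true, by decide⟩)
  simpa using MTailPat.of_good h

/-- **the cube of `(P(e²) ∧ P(e²)) ∗ (P(e²) ∧ P(e²))`** (8 free edges, max-flow 4) has an M♮-concave
counting tail of level 4 -/
theorem mtail_bb_par_bb : IsMTail (cnt (.par bb bb)) 4 := by
  have := (MTailPat.par_bb mtail_bb).1
  simpa [MTailPat] using this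

/-- (TAIL-LC) on that cube -/
theorem bb_par_bb_antidiag (a b : ℤ) :
    cnt (.par bb bb) (a + 1) (b - 1) * cnt (.par bb bb) (a - 1) (b + 1)
      ≤ cnt (.par bb bb) a b * cnt (.par bb bb) a b :=
  mtail_bb_par_bb.antidiag a b

end Summit.Ventures.PercRepro2.Tail2D
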